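import Summits.AtomisticToContinuum.Crystallization.Theorems.PricedLinkCensusLocalToGlobalFccMirrorSmearedWeak
import Summits.AtomisticToContinuum.Crystallization.Theorems.PricedLinkCensusLocalToGlobalFccMirrorLatticeSum
import Summits.AtomisticToContinuum.Crystallization.Theorems.PricedLinkCensusLocalToGlobalFccMirrorReflection
import Summits.AtomisticToContinuum.Crystallization.Theorems.PricedLinkCensusLocalToGlobalFccMirrorCell

/-!
# The field of the method of images: the lattice sum of smeared Newton fields over `fcc(a)`

Route `PricedLinkCensus`, crux `LocalToGlobal` (stmt-AtomisticToContinuum-14232), line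
`flux-cell-joint-census`, support for the registered stub `stub_fccMirrorExact : NewtonShell8 → FccMirrorExact`
(`Theorems/PricedLinkCensusLocalToGlobalDefs`), second half (`fluxCell ≤ S₆`).  THE CANDIDATE CONFINED FLUX of
the canonical cell `V = fccVoronoi a` is the restriction to the tube `V × ℝ⁵` of

  `latticeField a z = Σ'_{p ∈ fcc(a)} smearedField (a/2) (z - ι p)`,

the total Newton field of the infinite lattice of unit charges smeared on the 8-balls `B(ι p, a/2)`, with
potential `latticePotential a = Σ'_p smearedPotential (a/2) (· - ι p)` (`∇ latticePotential = -2π⁴ latticeField`,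
`PricedLinkCensusLocalToGlobalFccMirrorSmearedField`, `…LatticeSum`).  This file proves:

* `latticeField a` is continuous, `latticePotential a ∈ C¹`, transverse decay on the slab over `B(0, a)`;
* MIRROR SYMMETRY (registered sub-goal `fccMirror_latticeField_mirror`): for each of the twelve facet
  reflections `σ_w` (`w ∈ fcc(a)`, `‖w‖ = a`), `latticeField a (σ_w z) = R_w (latticeField a z)` with `R_w` the
  Householder reflection of `ℝ⁸` orthogonal to `ι w` (the smeared field is `O(8)`-equivariant and `σ_w` permutes
  the lattice, `PricedLinkCensusLocalToGlobalFccMirrorReflection`), whence THE NORMAL COMPONENT OF THE FIELD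
  VANISHES ON EVERY FACET PLANE `× ℝ⁵` (`inner_latticeField_emb_eq_zero`);
* THE GAUSS LAW IN THE TUBE FOR TESTS SUPPORTED IN THE TUBE: `∫ ⟪latticeField a, ∇Φ⟫ = -⨍_{B(0,a/2)} Φ` for
  `Φ ∈ C¹_c(ℝ⁸)` with `tsupport Φ ⊆ V × ℝ⁵` (sum of the Gauss laws of the smeared balls,
  `PricedLinkCensusLocalToGlobalFccMirrorSmearedWeak`; the balls of the other sites miss the tube,
  `PricedLinkCensusLocalToGlobalFccMirrorCell`).

References: W. Thomson (Lord Kelvin), method of images (1848); J. D. Jackson, *Classical Electrodynamics*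
(1999), §2.1; E. H. Lieb, M. Loss, *Analysis* (2001), §9.7; folklore.
-/

noncomputable section

open MeasureTheory Set Filter Metric Topology InnerProductSpace Function Literature.Geometry.DiscreteGeometry
open scoped RealInnerProductSpace BigOperators ENNReal

namespace Summit.AtomisticToContinuum.Crystallization.Theorems.PricedLinkCensusLocalToGlobal

/-! ### Definitions and regularity -/

/-- THE FIELD OF THE METHOD OF IMAGES: `Σ'_{p ∈ fcc(a)} smearedField (a/2) (z - ι p)`. [folklore] -/
def latticeField (a : ℝ) (z : E8) : E8 := ∑' p : fccSet a, smearedField (a / 2) (z - emb (p : E3))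

/-- ITS POTENTIAL (times `2π⁴`): `Σ'_{p ∈ fcc(a)} smearedPotential (a/2) (z - ι p)`. [folklore] -/
def latticePotential (a : ℝ) (z : E8) : ℝ := ∑' p : fccSet a, smearedPotential (a / 2) (z - emb (p : E3))

section Regularity

variable {a : ℝ}

/-- `latticeField a` is continuous (`a > 0`). [folklore] -/
theorem continuous_latticeField (ha : 0 < a) : Continuous (latticeField a) := by
  obtain ⟨C, -, hC⟩ := exists_norm_smearedField_le_weight (half_pos ha)
  exact continuous_tsum_translate ha.ne' (by norm_num : 3 < 7) hC (continuous_smearedField _)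

/-- The terms of the field are summable. [folklore] -/
theorem summable_latticeField (ha : 0 < a) (z : E8) : Summable fun p : fccSet a => smearedField (a / 2) (z - emb (p : E3)) := by
  obtain ⟨C, -, hC⟩ := exists_norm_smearedField_le_weight (half_pos ha)
  exact summable_translate ha.ne' (by norm_num : 3 < 7) hC z

/-- The terms of the potential are summable. [folklore] -/
theorem summable_latticePotential (ha : 0 < a) (z : E8) :
    Summable fun p : fccSet a => smearedPotential (a / 2) (z - emb (p : E3)) := by
  obtain ⟨C, -, hC⟩ := exists_abs_smearedPotential_le_weight (half_pos ha)
  exact summable_translate ha.ne' (by norm_num : 3 < 6) (f := smearedPotential (a / 2))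
    (fun y => by rw [Real.norm_eq_abs]; exact hC y) z

/-- **`∇ latticePotential a = -2π⁴ latticeField a`** (term-by-term differentiation). [folklore] -/
theorem hasFDerivAt_latticePotential (ha : 0 < a) (z : E8) :
    HasFDerivAt (latticePotential a) (InnerProductSpace.toDual ℝ E8 (-(2 * Real.pi ^ 4) • latticeField a z)) z := by
  obtain ⟨C, hC0, hC⟩ := exists_norm_smearedField_le_weight (half_pos ha)
  obtain ⟨C', -, hC'⟩ := exists_abs_smearedPotential_le_weight (half_pos ha)
  have hg : ∀ y, ‖-(2 * Real.pi ^ 4) • smearedField (a / 2) y‖ ≤ 2 * Real.pi ^ 4 * C * (1 + ‖y‖)⁻¹ ^ 7 := fun y => by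
    calc ‖-(2 * Real.pi ^ 4) • smearedField (a / 2) y‖ = 2 * Real.pi ^ 4 * ‖smearedField (a / 2) y‖ := by
          rw [norm_smul, norm_neg, Real.norm_of_nonneg (by positivity)]
      _ ≤ 2 * Real.pi ^ 4 * (C * (1 + ‖y‖)⁻¹ ^ 7) := mul_le_mul_of_nonneg_left (hC y) (by positivity)
      _ = _ := by ring
  have h := hasFDerivAt_tsum_translate ha.ne' (by norm_num : 3 < 7) (by norm_num : 3 < 6)
    (fun y => (hasFDerivAt_smearedPotential (a / 2) y).1) hg hC' z
  rw [latticeField, ← (summable_latticeField ha z).tsum_const_smul (-(2 * Real.pi ^ 4))]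
  exact h

/-- `latticePotential a ∈ C¹(ℝ⁸)`. [folklore] -/
theorem contDiff_one_latticePotential (ha : 0 < a) : ContDiff ℝ 1 (latticePotential a) :=
  contDiff_one_iff_hasFDerivAt.2 ⟨fun z => InnerProductSpace.toDual ℝ E8 (-(2 * Real.pi ^ 4) • latticeField a z),
    (InnerProductSpace.toDual ℝ E8).continuous.comp
      ((continuous_const (y := -(2 * Real.pi ^ 4))).smul (continuous_latticeField ha)),
    fun z => hasFDerivAt_latticePotential ha z⟩

/-- `∇ latticePotential a z = -2π⁴ latticeField a z`. [folklore] -/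
theorem gradient_latticePotential (ha : 0 < a) (z : E8) :
    gradient (latticePotential a) z = -(2 * Real.pi ^ 4) • latticeField a z := by
  rw [gradient, (hasFDerivAt_latticePotential ha z).fderiv, LinearIsometryEquiv.symm_apply_apply]

/-- **Transverse decay of the field on the slab**: `‖latticeField a z‖ ≤ C (1 + ‖perp z‖)⁻³` for `‖proj z‖ ≤ a`. [folklore] -/
theorem exists_norm_latticeField_le_slab (ha : 0 < a) :
    ∃ C : ℝ, 0 ≤ C ∧ ∀ z : E8, ‖proj z‖ ≤ a → ‖latticeField a z‖ ≤ C * (1 + ‖perpL z‖)⁻¹ ^ 3 := by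
  obtain ⟨C, hC0, hC⟩ := exists_norm_smearedField_le_weight (half_pos ha)
  obtain ⟨S, hS0, hS⟩ := exists_tsum_weight_le ha.ne' (by norm_num : 3 < 4) ha.le
  exact ⟨C * S, by positivity, fun z hz => norm_tsum_translate_le_slab ha.ne' (j := 3) hC hS hz⟩

/-- **Transverse decay of the potential on the slab**: `|latticePotential a z| ≤ C (1 + ‖perp z‖)⁻²` for
`‖proj z‖ ≤ a`. [folklore] -/
theorem exists_abs_latticePotential_le_slab (ha : 0 < a) :
    ∃ C : ℝ, 0 ≤ C ∧ ∀ z : E8, ‖proj z‖ ≤ a → |latticePotential a z| ≤ C * (1 + ‖perpL z‖)⁻¹ ^ 2 := by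
  obtain ⟨C, hC0, hC⟩ := exists_abs_smearedPotential_le_weight (half_pos ha)
  obtain ⟨S, hS0, hS⟩ := exists_tsum_weight_le ha.ne' (by norm_num : 3 < 4) ha.le
  refine ⟨C * S, by positivity, fun z hz => ?_⟩
  rw [← Real.norm_eq_abs]
  exact norm_tsum_translate_le_slab ha.ne' (j := 2) (f := smearedPotential (a / 2))
    (fun y => by rw [Real.norm_eq_abs]; exact hC y) hS hz

end Regularity

/-! ### Mirror symmetry -/

section Mirror

variable {a : ℝ}

/-- The Householder reflection as a linear isometric automorphism of `ℝ⁸`. [folklore] -/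
def reflEquiv (v : E8) : E8 ≃ₗᵢ[ℝ] E8 :=
  { LinearEquiv.ofInvolutive (reflL v : E8 →L[ℝ] E8).toLinearMap (reflL_involutive v) with
    norm_map' := norm_reflL v }

/-- `reflEquiv v` acts as `reflL v`. [folklore] -/
@[simp] theorem reflEquiv_apply (v z : E8) : reflEquiv v z = reflL v z := rfl

/-- **The point field is `O(8)`-equivariant** (for the Householder reflections). [folklore] -/
theorem pointField_reflL (v y : E8) : pointField (reflL v y) = reflL v (pointField y) := by
  rw [pointField, pointField, norm_reflL, map_smul]

/-- **The smeared field is equivariant**: `smearedField r (R y) = R (smearedField r y)` for the Householder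
reflections `R` (change of variables `w = R u` in the ball, `R` measure preserving, `R(B) = B`). [folklore] -/
theorem smearedField_reflL (r : ℝ) (v y : E8) : smearedField r (reflL v y) = reflL v (smearedField r y) := by
  have hmp : MeasurePreserving (reflEquiv v) (volume : Measure E8) volume := (reflEquiv v).measurePreserving
  have hemb : MeasurableEmbedding (reflEquiv v) := (reflEquiv v).toHomeomorph.measurableEmbedding
  have hpre : (reflEquiv v) ⁻¹' ball (0 : E8) r = ball 0 r := by
    ext u
    simp only [mem_preimage, mem_ball_zero_iff, reflEquiv_apply, norm_reflL]
  have h := hmp.setIntegral_preimage_emb hemb (fun w => pointField (reflL v y - w)) (ball 0 r)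
  rw [hpre] at h
  rw [smearedField, smearedField, setAverage_eq, setAverage_eq, ← h]
  simp only [reflEquiv_apply]
  have h2 : ∫ u in ball (0 : E8) r, pointField (reflL v y - reflL v u) = ∫ u in ball (0 : E8) r, reflL v (pointField (y - u)) :=
    integral_congr_ae (Eventually.of_forall fun u => by simp only; rw [← map_sub, pointField_reflL])
  rw [h2, ContinuousLinearMap.integral_comp_comm _ (integrableOn_pointField_sub y 0 r), map_smul]

/-- **MIRROR SYMMETRY OF THE FIELD OF IMAGES**: `latticeField a (σ_w z) = R_w (latticeField a z)` for every
facet reflection `σ_w`, `w ∈ fcc(a)`, `‖w‖ = a`. [folklore] -/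
theorem latticeField_facetRefl8 (ha : 0 < a) {w : E3} (hw : w ∈ fccSet a) (hwa : ‖w‖ = a) (z : E8) :
    latticeField a (facetRefl8 w z) = reflL (emb w) (latticeField a z) := by
  rw [latticeField, latticeField, ContinuousLinearMap.map_tsum _ (summable_latticeField ha z),
    ← Equiv.tsum_eq (facetReflEquiv ha hw hwa)]
  refine tsum_congr fun q => ?_
  rw [facetReflEquiv_apply, ← facetRefl8_emb, facetRefl8_sub, smearedField_reflL]

/-- **THE NORMAL COMPONENT VANISHES ON THE FACET PLANES**: `⟪latticeField a z, ι w⟫ = 0` whenever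
`2⟪proj z, w⟫ = ‖w‖²` (`w ∈ fcc(a)`, `‖w‖ = a`). [folklore] -/
theorem inner_latticeField_emb_eq_zero (ha : 0 < a) {w : E3} (hw : w ∈ fccSet a) (hwa : ‖w‖ = a) {z : E8}
    (hz : 2 * ⟪proj z, w⟫ = ‖w‖ ^ 2) : ⟪latticeField a z, emb w⟫ = 0 := by
  have h := latticeField_facetRefl8 ha hw hwa z
  rw [facetRefl8_of_mem_plane hz] at h
  exact inner_eq_zero_of_reflL_eq h.symm

/-- **Registered sub-goal `fccMirror_latticeField_mirror`** (line `flux-cell-joint-census`, support of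
`stub_fccMirrorExact`): mirror symmetry of the field of images, binder form of `latticeField_facetRefl8`. [folklore] -/
theorem fccMirror_latticeField_mirror : ∀ (a : ℝ), 0 < a → ∀ w ∈ fccSet a, ‖w‖ = a → ∀ z : E8,
    latticeField a (facetRefl8 w z) = reflL (emb w) (latticeField a z) :=
  fun _ ha _ hw hwa z => latticeField_facetRefl8 ha hw hwa z

end Mirror

/-! ### The Gauss law in the tube for tests supported in the tube -/

section Gauss

variable {a : ℝ}

/-- One translated term: `∫ ⟪smearedField r (z - e), ∇Φ(z)⟫ dz = -⨍_{B(e, r)} Φ`. [folklore] -/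
theorem integral_inner_smearedField_sub {r : ℝ} (hr : 0 < r) (e : E8) {Φ : E8 → ℝ} (hΦ : IsTest Φ) :
    ∫ z, ⟪smearedField r (z - e), gradient Φ z⟫ = -⨍ z in ball e r, Φ z := by
  have hψ := isTest_comp_add hΦ e
  have h1 : ∫ z, ⟪smearedField r (z - e), gradient Φ z⟫ = ∫ y, ⟪smearedField r y, gradient (fun w => Φ (w + e)) y⟫ := by
    rw [← integral_sub_right_eq_self (fun y => ⟪smearedField r y, gradient (fun w => Φ (w + e)) y⟫) e]
    refine integral_congr_ae (Eventually.of_forall fun z => ?_)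
    simp only
    rw [gradient_comp_add, sub_add_cancel]
  rw [h1, integral_inner_smearedField_gradient hr hψ.1 hψ.2]
  have h2 := setAverage_ball_add_center Φ 0 e r
  rw [zero_add] at h2
  rw [h2]

/-- Pointwise: the pairing of the lattice field with a vector is the sum of the pairings of the terms. [folklore] -/
theorem inner_latticeField_eq_tsum (ha : 0 < a) (z g : E8) :
    ⟪latticeField a z, g⟫ = ∑' p : fccSet a, ⟪smearedField (a / 2) (z - emb (p : E3)), g⟫ := by
  have h := ((summable_latticeField ha z).hasSum.mapL (innerSL ℝ g)).tsum_eq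
  simp only [innerSL_apply_apply] at h
  rw [latticeField, real_inner_comm, ← h]
  exact tsum_congr fun p => real_inner_comm _ _

/-- **THE GAUSS LAW OF THE FIELD OF IMAGES, for tests supported in the tube**: if `Φ ∈ C¹_c(ℝ⁸)` has
`tsupport Φ ⊆ V × ℝ⁵`, then `∫ ⟪latticeField a, ∇Φ⟫ = -⨍_{B(0, a/2)} Φ` (interchange of sum and integral;
each term is the Gauss law of one smeared ball; the balls of the sites `p ≠ 0` miss the tube). [folklore] -/
theorem integral_inner_latticeField_gradient (ha : 0 < a) {Φ : E8 → ℝ} (hΦ : IsTest Φ)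
    (hsupp : tsupport Φ ⊆ tube (fccVoronoi a)) :
    ∫ z, ⟪latticeField a z, gradient Φ z⟫ = -⨍ z in ball (0 : E8) (a / 2), Φ z := by
  haveI : Countable (fccSet a) := countable_fccSet ha.ne'
  obtain ⟨C, hC0, hC⟩ := exists_norm_smearedField_le_weight (half_pos ha)
  obtain ⟨K, hK0, -, hKg⟩ := exists_bounds_of_test hΦ.1 hΦ.2
  obtain ⟨R, hR⟩ := hΦ.2.isCompact.isBounded.subset_closedBall (0 : E8)
  set R' : ℝ := max R 0 with hR'
  have hR'0 : 0 ≤ R' := le_max_right _ _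
  have hgc : Continuous (gradient Φ) := Literature.Analysis.FluidPDE.continuous_gradient_of_contDiff hΦ.1
  have hg0 : ∀ z, z ∉ closedBall (0 : E8) R' → gradient Φ z = 0 := fun z hz =>
    Literature.Analysis.FluidPDE.gradient_eq_zero_of_notMem_tsupport fun h =>
      hz (closedBall_subset_closedBall (le_max_left _ _) (hR h))
  -- the terms `z ↦ ⟪smearedField (z - ι p), ∇Φ z⟫` and their majorants
  set T : fccSet a → E8 → ℝ := fun p z => ⟪smearedField (a / 2) (z - emb (p : E3)), gradient Φ z⟫ with hT
  set b : fccSet a → ℝ := fun p => C * (1 + R') ^ 7 * K * (volume : Measure E8).real (closedBall 0 R') *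
    (1 + ‖emb (p : E3)‖)⁻¹ ^ 7 with hb
  have hbs : Summable b := by
    have h := (summable_weight_fcc8 ha.ne' (by norm_num : 3 < 7) 0).mul_left
      (C * (1 + R') ^ 7 * K * (volume : Measure E8).real (closedBall 0 R'))
    simp only [zero_sub, norm_neg] at h
    exact h
  have hTm : ∀ p, AEStronglyMeasurable (T p) volume := fun p =>
    (((continuous_smearedField _).comp (continuous_id.sub continuous_const)).inner hgc).aestronglyMeasurable
  have hTbd : ∀ p z, ‖T p z‖ ≤ (closedBall (0 : E8) R').indicator
      (fun _ => C * (1 + R') ^ 7 * K * (1 + ‖emb (p : E3)‖)⁻¹ ^ 7) z := fun p z => by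
    by_cases hz : z ∈ closedBall (0 : E8) R'
    · rw [indicator_of_mem hz, Real.norm_eq_abs]
      refine (abs_real_inner_le_norm _ _).trans ?_
      have h1 : ‖smearedField (a / 2) (z - emb (p : E3))‖ ≤ C * ((1 + R') * (1 + ‖emb (p : E3)‖)⁻¹) ^ 7 := by
        refine (hC _).trans (mul_le_mul_of_nonneg_left (pow_le_pow_left₀ (by positivity) ?_ 7) hC0)
        have := inv_one_add_norm_sub_le (x := emb (p : E3)) hR'0 (mem_closedBall_zero_iff.1 hz)
        rwa [norm_sub_rev] at this
      calc ‖smearedField (a / 2) (z - emb (p : E3))‖ * ‖gradient Φ z‖ ≤ C * ((1 + R') * (1 + ‖emb (p : E3)‖)⁻¹) ^ 7 * K :=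
            mul_le_mul h1 (hKg z) (norm_nonneg _) (by positivity)
        _ = C * (1 + R') ^ 7 * K * (1 + ‖emb (p : E3)‖)⁻¹ ^ 7 := by ring
    · rw [indicator_of_notMem hz, hT]
      simp only
      rw [hg0 z hz, inner_zero_right, norm_zero]
  have hTi : ∀ p, Integrable (T p) := fun p =>
    ((integrable_indicator_iff measurableSet_closedBall).2 (integrableOn_const measure_closedBall_lt_top.ne)).mono'
      (hTm p) (Eventually.of_forall (hTbd p))
  have hTib : ∀ p, ∫ z, ‖T p z‖ ≤ b p := fun p => by
    refine (integral_mono (hTi p).norm ((integrable_indicator_iff measurableSet_closedBall).2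
      (integrableOn_const measure_closedBall_lt_top.ne)) (hTbd p)).trans_eq ?_
    rw [integral_indicator measurableSet_closedBall, setIntegral_const, smul_eq_mul, hb]
    ring
  -- interchange of sum and integral
  have hswap : ∫ z, ∑' p, T p z = ∑' p, ∫ z, T p z := by
    have hle : ∑' p, ∫⁻ z, ‖T p z‖ₑ ≤ ENNReal.ofReal (∑' p, b p) := by
      rw [ENNReal.ofReal_tsum_of_nonneg (fun p => by positivity) hbs]
      refine ENNReal.tsum_le_tsum fun p => ?_
      rw [← ofReal_integral_norm_eq_lintegral_enorm (hTi p)]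
      exact ENNReal.ofReal_le_ofReal (hTib p)
    exact integral_tsum hTm (ne_top_of_le_ne_top ENNReal.ofReal_ne_top hle)
  -- assemble
  have h1 : ∫ z, ⟪latticeField a z, gradient Φ z⟫ = ∫ z, ∑' p, T p z :=
    integral_congr_ae (Eventually.of_forall fun z => inner_latticeField_eq_tsum ha z _)
  rw [h1, hswap]
  have h2 : ∀ p : fccSet a, ∫ z, T p z = -⨍ z in ball (emb (p : E3)) (a / 2), Φ z := fun p =>
    integral_inner_smearedField_sub (half_pos ha) _ hΦ
  simp_rw [h2]
  rw [tsum_eq_single (⟨0, zero_mem_fccSet a⟩ : fccSet a) fun p hp => ?_]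
  · simp [emb_zero]
  · have hp0 : (p : E3) ≠ 0 := fun h => hp (Subtype.ext h)
    rw [neg_eq_zero]
    have hzero : ∀ z ∈ ball (emb (p : E3)) (a / 2), Φ z = 0 := fun z hz =>
      image_eq_zero_of_notMem_tsupport fun h => not_mem_tube_of_mem_ball p.2 hp0 hz (hsupp h)
    rw [setAverage_congr_fun measurableSet_ball (Eventually.of_forall hzero)]
    simp

end Gauss

end Summit.AtomisticToContinuum.Crystallization.Theorems.PricedLinkCensusLocalToGlobal

end
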